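import Summits.FinalStateConjecture.FinalStateConjecture.Theorems.PhotonSphereChannelsChannelsResolveTameDevelopmentsRFlatHorizonLag
import Summits.FinalStateConjecture.FinalStateConjecture.Theorems.PhotonSphereChannelsChannelsResolveTameDevelopmentsRKerrDocTransfer
import Literature.Geometry.Lorentzian.CommonDevelopmentEmbedding
import Literature.Geometry.Manifold.DirectLimitManifold
import HarnessLib

/-!
# Route PhotonSphereChannels · crux `ChannelsResolveTameDevelopmentsR` (K2R-T2, stmt-FinalStateConjecture-17430) ·
# line `tame-lasalle-dock` · stub D, input (I) "asymptotic inertiality": TRANSPORT of the lag criterion to an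
# arbitrary flat spacetime

Input (I) of the stub-D reduction `dockReadyHull_of_inertial_of_collar_of_full` (lead c8) reads
`IsMinkowski 𝓢 → 𝓢.blackHoleRegionOfEnd (range E.far) = ∅` for silent hull elements `(𝓢, E, p)`. The two predecessors
settle it on Minkowski spacetime itself: `…RFlatHorizonCriterion` (p164621: empty black-hole region and horizon iff the
retarded time is unbounded on the far chart; transport FORWARD along a flat presentation `Ψ : ℝ⁴ → 𝓢`) and
`…RFlatHorizonLag` (p165587: on `(ℝ⁴, η, ∂ₜ)`, one far-chart observer whose chart velocity grows at most linearly makes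
the retarded time unbounded). This file moves the END DATUM the other way, so that (I) for a general flat `𝓢` becomes a
statement about ONE inertial observer:

* §1 the flat presentation `Ψ` (the four fields of `TameHull.IsMinkowski 𝓢`: bijective, smooth, `Ψ^* g = η`, `Ψ_* ∂₀`
  future) is an isometric immersion `(ℝ⁴₁) → 𝓢` mapping EVERY future-directed vector to a future-directed vector
  (`isFutureDirected_mfderiv_of_flatPresentation`), hence a local diffeomorphism
  (`LorentzianMetric.isLocalDiffeomorph_of_isIsometricImmersion`) and a local isometry, with smooth inverse
  `Ψ⁻¹ = Function.invFun Ψ` (`contMDiff_invFun_of_flatPresentation`, the tree's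
  `IsLocalDiffeomorph.contMDiffOn_symm_of_injective`);
* §2 the INERTIAL READING `Ψ⁻¹ ∘ E.far` of the far chart of an end datum `E` of `𝓢` is smooth, has the SAME deviation `h`
  (`h_inertialEnd_eq`: `Ψ` is a local isometry, `deviation_comp_of_isLocalIsometry`), and `∂₀` future-directed
  (`isFutureDirected_of_mfderiv_of_isLocalIsometry`);
* §3 hence (I) + (G6) for `E` from ONE far radius `‖y‖ ≥ 4 E.M + 2C` at which the inertial chart velocity
  `d(Ψ⁻¹ ∘ E.far)_{(t, y)} ∂₀` grows at most linearly in chart time (`horizon_eq_empty_of_linear_inertial_growth`), and the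
  packaged form from `E.IsTameEnd Λ r₀` (`flatHorizonTransport`, registered sub-goal).

What then remains of (I) is the pure Minkowski-geometry SLICE RIGIDITY estimate (evidence note
G6-LAG-AND-SLICE-RIGIDITY-s64.md): a tame far slice of `ℝ⁴₁` is asymptotic to a hyperplane at a uniform rate, which
bounds `d(Ψ⁻¹ ∘ E.far) ∂₀` at one radius uniformly in time. No route item is restated.

References: O'Neill 1983, Ch. 3, pp. 58, 90–91; Ch. 5, Lemma 5.29, p. 145; Ch. 14, pp. 402–403 [ONeill1983];
Lee 2013, Thm. 4.5 [LeeSmoothManifolds2013]; Wald 1984, §12.1 [Wald1984].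
-/

noncomputable section

set_option maxSynthPendingDepth 3
set_option linter.dupNamespace false

open Set Filter Function TopologicalSpace Manifold Bundle
open scoped Topology Manifold ContDiff ENNReal NNReal

namespace Summit.FinalStateConjecture.FinalStateConjecture.Theorems.TameLaSalle.FlatHorizon

open Literature.Geometry.Lorentzian
open Summit.FinalStateConjecture.FinalStateConjecture.Theorems.TameHull
open Summit.FinalStateConjecture.FinalStateConjecture.Theorems.DarkFuture
  (deviation_comp_of_isLocalIsometry isFutureDirected_of_mfderiv_of_isLocalIsometry)

/-! ### §1 The flat presentation as a local isometry with smooth inverse -/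

section Presentation

variable {𝓢 : Spacetime.{0} 4} {Ψ : E4 → 𝓢.carrier}

/-- `Ψ^* g = η` pointwise: `g(dΨ a, dΨ b) = η(a, b)`. O'Neill 1983, Ch. 3, p. 58. [cite: ONeill1983, Ch. 3, p. 58] -/
theorem val_mfderiv_of_flatPresentation (hdev : ∀ x, 𝓢.minkowskiDeviation Ψ x = 0) (x : E4) (a b : E4) :
    𝓢.metric.val (Ψ x) (mfderiv 𝓘(ℝ, E4) (𝓡 4) Ψ x a) (mfderiv 𝓘(ℝ, E4) (𝓡 4) Ψ x b) = Minkowski.bilin a b := by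
  have h := congrArg (fun β : E4 →L[ℝ] E4 →L[ℝ] ℝ ↦ β a b) (hdev x)
  simp only [Spacetime.minkowskiDeviation_apply, zero_apply, sub_eq_zero] at h
  exact h

/-- **A flat presentation maps future-directed vectors to future-directed vectors** (not only `∂₀`): for a
future-directed `v` of `ℝ⁴₁`, `w = dΨ v` is causal (`g(w, w) = η(v, v) ≤ 0`, `w ≠ 0` by nondegeneracy of `η`) and
pairs negatively with the future timelike `dΨ ∂₀` (`g(dΨ ∂₀, w) = η(∂₀, v) < 0`). O'Neill 1983, Ch. 5, Lemma 5.29,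
p. 145. [cite: ONeill1983, Ch. 5, Lemma 5.29 and p. 145] -/
theorem isFutureDirected_mfderiv_of_flatPresentation (hdev : ∀ x, 𝓢.minkowskiDeviation Ψ x = 0)
    (hfut : ∀ x, 𝓢.timeOrientation.IsFutureDirected (mfderiv 𝓘(ℝ, E4) (𝓡 4) Ψ x (E4.basisVector 0)))
    (x : E4) (v : E4) (hv : Minkowski.spacetime.timeOrientation.IsFutureDirected (x := x) v) :
    𝓢.timeOrientation.IsFutureDirected (mfderiv 𝓘(ℝ, E4) (𝓡 4) Ψ x v) := by
  have hg := val_mfderiv_of_flatPresentation hdev x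
  have hvv : Minkowski.bilin v v ≤ 0 := hv.1.1
  have hvne : v ≠ 0 := hv.1.2
  have hTv : Minkowski.bilin (E4.basisVector 0) v < 0 := hv.2
  have hww : 𝓢.metric.val (Ψ x) (mfderiv 𝓘(ℝ, E4) (𝓡 4) Ψ x v) (mfderiv 𝓘(ℝ, E4) (𝓡 4) Ψ x v) ≤ 0 := by
    rw [hg]; exact hvv
  have hwne : mfderiv 𝓘(ℝ, E4) (𝓡 4) Ψ x v ≠ 0 := fun h0 ↦ hvne (Minkowski.bilin_nondegenerate v fun u ↦ by
    rw [← hg v u, h0, map_zero, zero_apply])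
  have hTT : 𝓢.metric.IsTimelike (mfderiv 𝓘(ℝ, E4) (𝓡 4) Ψ x (E4.basisVector 0)) := by
    change 𝓢.metric.val _ _ _ < 0
    rw [hg, Minkowski.bilin_basisVector_zero_left]
    simp
  have hTw : 𝓢.metric.val (Ψ x) (mfderiv 𝓘(ℝ, E4) (𝓡 4) Ψ x (E4.basisVector 0))
      (mfderiv 𝓘(ℝ, E4) (𝓡 4) Ψ x v) < 0 := by rw [hg]; exact hTv
  exact (𝓢.timeOrientation.isFutureDirected_iff_val_neg (hfut x) hTT ⟨hww, hwne⟩).2 hTw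

/-- **A flat presentation is an isometric immersion `ℝ⁴₁ → 𝓢`** (`Ψ^* g = η` as fibrewise bilinear forms).
O'Neill 1983, Ch. 3, p. 58. [cite: ONeill1983, Ch. 3, p. 58] -/
theorem isIsometricImmersion_of_flatPresentation (hsm : ContMDiff 𝓘(ℝ, E4) (𝓡 4) ∞ Ψ)
    (hdev : ∀ x, 𝓢.minkowskiDeviation Ψ x = 0) :
    Minkowski.spacetime.metric.IsIsometricImmersion 𝓢.metric.toPseudoRiemannianMetric Ψ := by
  refine ⟨hsm, fun y ↦ ?_⟩
  have h := hdev y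
  rw [Spacetime.minkowskiDeviation, sub_eq_zero] at h
  exact h

/-- **A flat presentation is a local diffeomorphism** (isometric immersion between equidimensional Lorentzian
manifolds; inverse function theorem). O'Neill 1983, Ch. 3, p. 90. [cite: ONeill1983, Ch. 3, p. 90] -/
theorem isLocalDiffeomorph_of_flatPresentation (hsm : ContMDiff 𝓘(ℝ, E4) (𝓡 4) ∞ Ψ)
    (hdev : ∀ x, 𝓢.minkowskiDeviation Ψ x = 0) : IsLocalDiffeomorph 𝓘(ℝ, E4) (𝓡 4) ∞ Ψ :=
  LorentzianMetric.isLocalDiffeomorph_of_isIsometricImmersion (isIsometricImmersion_of_flatPresentation hsm hdev)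

/-- **A flat presentation is a local isometry `ℝ⁴₁ → 𝓢`.** O'Neill 1983, Ch. 3, pp. 90–91.
[cite: ONeill1983, Ch. 3, pp. 90–91] -/
theorem isLocalIsometry_of_flatPresentation (hsm : ContMDiff 𝓘(ℝ, E4) (𝓡 4) ∞ Ψ)
    (hdev : ∀ x, 𝓢.minkowskiDeviation Ψ x = 0) :
    PseudoRiemannianMetric.IsLocalIsometry Minkowski.spacetime.metric.toPseudoRiemannianMetric
      𝓢.metric.toPseudoRiemannianMetric Ψ :=
  ⟨isLocalDiffeomorph_of_flatPresentation hsm hdev, (isIsometricImmersion_of_flatPresentation hsm hdev).2⟩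

/-- **The inverse of a bijective flat presentation is smooth** (`Ψ⁻¹ = Function.invFun Ψ`): the inverse of an
injective local diffeomorphism is smooth on its range (`IsLocalDiffeomorph.contMDiffOn_symm_of_injective`), which is
everything, and it agrees with `Function.invFun Ψ`. Lee 2013, Thm. 4.5. [cite: LeeSmoothManifolds2013, Thm. 4.5] -/
theorem contMDiff_invFun_of_flatPresentation (hΨ : Function.Bijective Ψ) (hsm : ContMDiff 𝓘(ℝ, E4) (𝓡 4) ∞ Ψ)
    (hdev : ∀ x, 𝓢.minkowskiDeviation Ψ x = 0) : ContMDiff (𝓡 4) 𝓘(ℝ, E4) ∞ (Function.invFun Ψ) := by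
  have hld := isLocalDiffeomorph_of_flatPresentation hsm hdev
  set e := (hld.isOpenEmbedding_of_injective hΨ.1).toOpenPartialHomeomorph Ψ with he
  have hsymm : ContMDiffOn (𝓡 4) 𝓘(ℝ, E4) ∞ e.symm (Set.range Ψ) := hld.contMDiffOn_symm_of_injective hΨ.1
  rw [hΨ.2.range_eq] at hsymm
  have heq : (Function.invFun Ψ : 𝓢.carrier → E4) = e.symm := by
    funext y
    obtain ⟨x, rfl⟩ := hΨ.2 y
    rw [Function.leftInverse_invFun hΨ.1 x]
    exact ((hld.isOpenEmbedding_of_injective hΨ.1).toOpenPartialHomeomorph_left_inv Ψ).symm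
  rw [heq]
  exact contMDiffOn_univ.1 hsymm

end Presentation

/-! ### §2 The inertial reading of an end datum -/

section Inertial

variable {𝓢 : Spacetime.{0} 4} {Ψ : E4 → 𝓢.carrier}

/-- **The inertial reading of the far chart is smooth**: `Ψ⁻¹ ∘ E.far` for a bijective flat presentation `Ψ` and a
smooth far chart. [folklore] -/
theorem contMDiff_invFun_comp_far (E : EndDatum 𝓢) (hΨ : Function.Bijective Ψ) (hsm : ContMDiff 𝓘(ℝ, E4) (𝓡 4) ∞ Ψ)
    (hdev : ∀ x, 𝓢.minkowskiDeviation Ψ x = 0) (hfar : ContMDiff 𝓘(ℝ, E4) (𝓡 4) ∞ E.far) :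
    ContMDiff 𝓘(ℝ, E4) (𝓡 4) ∞ (Function.invFun Ψ ∘ E.far) :=
  (contMDiff_invFun_of_flatPresentation hΨ hsm hdev).comp hfar

/-- **The inertial reading has the same far deviation**: for `x` in the far cylinder,
`h[Ψ⁻¹ ∘ far](x) = h[far](x)`, because `Ψ` is a local isometry and `Ψ ∘ (Ψ⁻¹ ∘ far) = far`
(`deviation_comp_of_isLocalIsometry`). O'Neill 1983, Ch. 3, pp. 90–91. [cite: ONeill1983, Ch. 3, pp. 90–91] -/
theorem h_inertialEnd_eq (E : EndDatum 𝓢) (hΨ : Function.Bijective Ψ) (hsm : ContMDiff 𝓘(ℝ, E4) (𝓡 4) ∞ Ψ)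
    (hdev : ∀ x, 𝓢.minkowskiDeviation Ψ x = 0) (hfar : ContMDiff 𝓘(ℝ, E4) (𝓡 4) ∞ E.far)
    (x : Kerr.region (0 : ℝ) E.R) :
    (⟨E.M, E.R, E.C, Function.invFun Ψ ∘ E.far, fun _ ↦ 0⟩ : EndDatum Minkowski.spacetime).h x.1 = E.h x.1 := by
  have hmd : MDifferentiable 𝓘(ℝ, E4) (𝓡 4) (Function.invFun Ψ ∘ E.far) :=
    (contMDiff_invFun_comp_far E hΨ hsm hdev hfar).mdifferentiable (by simp)
  have hcomp : Ψ ∘ (Function.invFun Ψ ∘ E.far) = E.far := by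
    funext z
    exact Function.rightInverse_invFun hΨ.2 (E.far z)
  change Minkowski.spacetime.deviationExtend (farBackground E.M E.R) (Function.invFun Ψ ∘ E.far) x.1 =
    𝓢.deviationExtend (farBackground E.M E.R) E.far x.1
  rw [Spacetime.deviationExtend_coe, Spacetime.deviationExtend_coe]
  -- `Ψ` is a local isometry: the deviation of `Ψ ∘ (Ψ⁻¹ ∘ far) = far` in `𝓢` is that of `Ψ⁻¹ ∘ far` in `ℝ⁴₁`
  have key := deviation_comp_of_isLocalIsometry (farBackground E.M E.R)
    (isLocalIsometry_of_flatPresentation hsm hdev) hmd x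
  have key2 := congrArg (fun F : Kerr.region (0 : ℝ) E.R → 𝓢.carrier ↦ 𝓢.deviation (farBackground E.M E.R) F x)
    hcomp
  exact key.symm.trans key2

/-- **The inertial reading has future-directed `∂₀`**: `dΨ (d(Ψ⁻¹ ∘ far) ∂₀) = dfar ∂₀` is future-directed in `𝓢`,
and future-directedness pulls back along the orientation-preserving local isometry `Ψ`
(`isFutureDirected_of_mfderiv_of_isLocalIsometry`). O'Neill 1983, Ch. 5, p. 145. [cite: ONeill1983, Ch. 5, p. 145] -/
theorem isFutureDirected_mfderiv_inertialFar (E : EndDatum 𝓢) (hΨ : Function.Bijective Ψ)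
    (hsm : ContMDiff 𝓘(ℝ, E4) (𝓡 4) ∞ Ψ) (hdev : ∀ x, 𝓢.minkowskiDeviation Ψ x = 0)
    (hfut : ∀ x, 𝓢.timeOrientation.IsFutureDirected (mfderiv 𝓘(ℝ, E4) (𝓡 4) Ψ x (E4.basisVector 0)))
    (hfar : ContMDiff 𝓘(ℝ, E4) (𝓡 4) ∞ E.far)
    (hfarfut : ∀ x : Kerr.region (0 : ℝ) E.R, 𝓢.timeOrientation.IsFutureDirected
      (mfderiv 𝓘(ℝ, E4) (𝓡 4) E.far x (E4.basisVector 0)))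
    (x : Kerr.region (0 : ℝ) E.R) :
    Minkowski.spacetime.timeOrientation.IsFutureDirected
      (mfderiv 𝓘(ℝ, E4) (𝓡 4) (Function.invFun Ψ ∘ E.far) x (E4.basisVector 0)) := by
  have hmd : MDifferentiableAt 𝓘(ℝ, E4) (𝓡 4) (Function.invFun Ψ ∘ E.far) x :=
    (contMDiff_invFun_comp_far E hΨ hsm hdev hfar).mdifferentiableAt (by simp)
  have hΨmd : MDifferentiableAt 𝓘(ℝ, E4) (𝓡 4) Ψ ((Function.invFun Ψ ∘ E.far) x) := hsm.mdifferentiableAt (by simp)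
  have hcomp : Ψ ∘ (Function.invFun Ψ ∘ E.far) = E.far := by
    funext z
    exact Function.rightInverse_invFun hΨ.2 (E.far z)
  -- `dΨ (d(Ψ⁻¹ ∘ far) ∂₀) = dfar ∂₀`
  have hchain : mfderiv 𝓘(ℝ, E4) (𝓡 4) Ψ ((Function.invFun Ψ ∘ E.far) x)
      (mfderiv 𝓘(ℝ, E4) (𝓡 4) (Function.invFun Ψ ∘ E.far) x (E4.basisVector 0)) =
        mfderiv 𝓘(ℝ, E4) (𝓡 4) E.far x (E4.basisVector 0) := by
    have h := mfderiv_comp x hΨmd hmd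
    rw [hcomp] at h
    rw [h]
    rfl
  have hpt : Ψ ((Function.invFun Ψ ∘ E.far) x) = E.far x := Function.rightInverse_invFun hΨ.2 (E.far x)
  refine isFutureDirected_of_mfderiv_of_isLocalIsometry (isLocalIsometry_of_flatPresentation hsm hdev)
    (fun y v hv ↦ isFutureDirected_mfderiv_of_flatPresentation hdev hfut y v hv) ?_
  -- transport `hfarfut x` along the base point (`hpt`) and the vector (`hchain`)
  have key : ∀ p : 𝓢.carrier, p = E.far x → ∀ u : E4, u = mfderiv 𝓘(ℝ, E4) (𝓡 4) E.far x (E4.basisVector 0) →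
      𝓢.timeOrientation.IsFutureDirected (x := p) u := by
    rintro p rfl u rfl
    exact hfarfut x
  exact key _ hpt _ hchain

end Inertial

/-! ### §3 (I) + (G6) for a general flat spacetime from one slowly drifting inertial observer -/

section Ends

variable {𝓢 : Spacetime.{0} 4}

/-- **(I) + (G6) from ONE slowly drifting inertial observer of the far chart.** Let `𝓢` be presented as Minkowski
space by `Ψ` (bijective, smooth, `Ψ^* g = η`, `Ψ_* ∂₀` future) and let `E` be an end datum of `𝓢` with smooth far
chart, `far_* ∂₀` future, and `‖h‖ · r ≤ C` on the far cylinder. If at ONE radius `‖y‖ ≥ 4 E.M + 2 C` of the cylinder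
the inertial chart velocity `d(Ψ⁻¹ ∘ E.far)_{(t,y)} ∂₀` grows at most linearly in chart time `t ≥ 0`, then
`E.horizon = ∅` and `𝓢.blackHoleRegionOfEnd (range E.far) = ∅`. Proof: the inertial reading is an end datum of
`(ℝ⁴, η, ∂ₜ)` with the same `h` (§2), so its observer at `y` is uniformly timelike (`bilin_mfderiv_far_le`) and the
retarded time is unbounded along it (`forall_exists_lt_of_linear_growth`); transport forward by `flatHorizonCriterion`.
Wald 1984, §12.1; O'Neill 1983, Ch. 14, pp. 402–403. [cite: Wald1984, §12.1] -/
theorem horizon_eq_empty_of_linear_inertial_growth (E : EndDatum 𝓢) {Ψ : E4 → 𝓢.carrier}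
    (hΨ : Function.Bijective Ψ) (hsm : ContMDiff 𝓘(ℝ, E4) (𝓡 4) ∞ Ψ)
    (hdev : ∀ x, 𝓢.minkowskiDeviation Ψ x = 0)
    (hfut : ∀ x, 𝓢.timeOrientation.IsFutureDirected (mfderiv 𝓘(ℝ, E4) (𝓡 4) Ψ x (E4.basisVector 0)))
    (hfar : ContMDiff 𝓘(ℝ, E4) (𝓡 4) ∞ E.far)
    (hfarfut : ∀ x : Kerr.region (0 : ℝ) E.R, 𝓢.timeOrientation.IsFutureDirected
      (mfderiv 𝓘(ℝ, E4) (𝓡 4) E.far x (E4.basisVector 0)))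
    {C : ℝ} (hC : ∀ x : Kerr.region (0 : ℝ) E.R, ‖E.h x.1‖ * Kerr.radius 0 x.1 ≤ C)
    {y : E3} (hy : max E.R 0 < ‖y‖) (hyC : 4 * E.M + 2 * C ≤ ‖y‖) {K : ℝ} (hK : 0 < K)
    (hgr : ∀ x : Kerr.region (0 : ℝ) E.R, E4.spatial x.1 = y → 0 ≤ x.1 0 →
      ‖(id (mfderiv 𝓘(ℝ, E4) (𝓡 4) (Function.invFun Ψ ∘ E.far) x (E4.basisVector 0)) : E4)‖ ≤ K * (1 + x.1 0)) :
    E.horizon = ∅ ∧ 𝓢.blackHoleRegionOfEnd (Set.range E.far) = ∅ := by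
  -- the inertial end datum of Minkowski spacetime
  set E' : EndDatum Minkowski.spacetime := ⟨E.M, E.R, E.C, Function.invFun Ψ ∘ E.far, fun _ ↦ 0⟩ with hE'
  have hfar' : ContMDiff 𝓘(ℝ, E4) (𝓡 4) ∞ E'.far := contMDiff_invFun_comp_far E hΨ hsm hdev hfar
  have hC' : ∀ x : Kerr.region (0 : ℝ) E'.R, ‖E'.h x.1‖ * Kerr.radius 0 x.1 ≤ C := fun x ↦ by
    have h := h_inertialEnd_eq E hΨ hsm hdev hfar x
    rw [h]
    exact hC x
  have hfut' : ∀ x : Kerr.region (0 : ℝ) E'.R, Minkowski.spacetime.timeOrientation.IsFutureDirected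
      (mfderiv 𝓘(ℝ, E4) (𝓡 4) E'.far x (E4.basisVector 0)) :=
    fun x ↦ isFutureDirected_mfderiv_inertialFar E hΨ hsm hdev hfut hfar hfarfut x
  -- the lifted time axis at `y`, read inertially
  have hmem : ∀ t : ℝ, E4.ofTimeSpace t y ∈ Kerr.region (0 : ℝ) E'.R := fun t ↦ by
    rw [Kerr.mem_region, Kerr.radius_zero_left, E4.spatialNorm_ofTimeSpace]
    exact hy
  set c : ℝ → Kerr.region (0 : ℝ) E'.R := fun t ↦ ⟨E4.ofTimeSpace t y, hmem t⟩ with hc_def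
  have hc : ∀ t, (c t : E4) = E4.ofTimeSpace t y := fun t ↦ rfl
  set w : ℝ → E4 := fun t ↦ (id (mfderiv 𝓘(ℝ, E4) (𝓡 4) E'.far (c t) (E4.basisVector 0)) : E4) with hw_def
  have hγ : ∀ t, HasDerivAt (fun s ↦ (id (E'.far (c s)) : E4)) (w t) t :=
    fun t ↦ hasDerivAt_far_timeAxis E' hfar' c hc t
  have hrad : ∀ t, Kerr.radius 0 (c t).1 = ‖y‖ := fun t ↦ by
    rw [Kerr.radius_zero_left, hc, E4.spatialNorm_ofTimeSpace]
  have hbil : ∀ t, 0 ≤ t → Minkowski.bilin (w t) (w t) ≤ -(1 / 2 : ℝ) := fun t _ ↦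
    bilin_mfderiv_far_le E' hC' (c t) (by rw [hrad]; exact hyC)
  have h0 : ∀ t, 0 ≤ t → 0 ≤ w t 0 := fun t _ ↦ by
    have h := (hfut' (c t)).2
    change Minkowski.bilin (E4.basisVector 0) (w t) < 0 at h
    rw [Minkowski.bilin_basisVector_zero_left] at h
    linarith
  have hgr' : ∀ t, 0 ≤ t → ‖w t‖ ≤ K * (1 + t) := fun t ht ↦ by
    have h := hgr (c t) (by rw [hc, E4.spatial_ofTimeSpace]) (by rw [hc, E4.ofTimeSpace_apply_zero]; exact ht)
    rwa [hc, E4.ofTimeSpace_apply_zero] at h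
  have hcrit := forall_exists_lt_of_linear_growth hγ (by norm_num : (0 : ℝ) < 1 / 2) hK hbil h0 hgr'
  -- transport forward along `Ψ`
  refine flatHorizonCriterion E Ψ hΨ hsm hdev hfut fun a ↦ ?_
  obtain ⟨T, -, hT⟩ := hcrit a
  refine ⟨E'.far (c T), ⟨c T, ?_⟩, hT⟩
  exact (Function.rightInverse_invFun hΨ.2 (E.far (c T))).symm

/-- **(I) + (G6) for a TAME end of a flat spacetime from one slowly drifting inertial observer (registered sub-goal
`flatHorizonTransport` of stmt-FinalStateConjecture-17430).** For `𝓢` presented as Minkowski space by `Ψ` (the four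
fields of `TameHull.IsMinkowski 𝓢`) and `E.IsTameEnd Λ r₀`: if at ONE radius `‖y‖ ≥ 4 E.M + 2 E.C` of the far cylinder the
inertial chart velocity `d(Ψ⁻¹ ∘ E.far)_{(t,y)} ∂₀` (`Ψ⁻¹ = Function.invFun Ψ`; `id` retypes the tangent vector as a
vector of `E4`) grows at most linearly in chart time `t ≥ 0`, then `E.horizon = ∅` and the black-hole region of
`range E.far` is empty. What remains of input (I) of stub D is therefore the slice-rigidity estimate on `(ℝ⁴, η)`.
Wald 1984, §12.1. [cite: Wald1984, §12.1] -/
theorem flatHorizonTransport : ∀ {𝓢 : Spacetime.{0} 4} (E : EndDatum 𝓢) (Ψ : E4 → 𝓢.carrier), Function.Bijective Ψ → ContMDiff 𝓘(ℝ, E4) (𝓡 4) ∞ Ψ → (∀ x : E4, 𝓢.minkowskiDeviation Ψ x = 0) → (∀ x : E4, 𝓢.timeOrientation.IsFutureDirected (mfderiv 𝓘(ℝ, E4) (𝓡 4) Ψ x (E4.basisVector 0))) → ∀ (Λ : ℝ≥0) (r₀ : ℝ), E.IsTameEnd Λ r₀ → ∀ (y : E3), max E.R 0 < ‖y‖ →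 4 * E.M + 2 * E.C ≤ ‖y‖ → ∀ (K : ℝ), 0 < K → (∀ x : Kerr.region (0 : ℝ) E.R, E4.spatial x.1 = y → 0 ≤ x.1 0 → ‖(id (mfderiv 𝓘(ℝ, E4) (𝓡 4) (Function.invFun Ψ ∘ E.far) x (E4.basisVector 0)) : E4)‖ ≤ K * (1 + x.1 0)) → E.horizon = ∅ ∧ 𝓢.blackHoleRegionOfEnd (Set.range E.far) = ∅ := by
  intro 𝓢 E Ψ hΨ hsm hdev hfut Λ r₀ hE y hy hyC K hK hgr
  have hfar : ContMDiff 𝓘(ℝ, E4) (𝓡 4) ∞ E.far := hE.far_isLocalDiffeomorph.contMDiff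
  have hC : ∀ x : Kerr.region (0 : ℝ) E.R, ‖E.h x.1‖ * Kerr.radius 0 x.1 ≤ E.C := fun x ↦ by
    have h := hE.far_bound 0 (by norm_num) x
    rwa [norm_iteratedFDeriv_zero] at h
  exact horizon_eq_empty_of_linear_inertial_growth E hΨ hsm hdev hfut hfar hE.far_future hC hy hyC hK hgr

end Ends

end Summit.FinalStateConjecture.FinalStateConjecture.Theorems.TameLaSalle.FlatHorizon

end
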